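import Mathlib

/-!
# SoloBlind — lattice Gaussian-domination bookkeeping (abstract Proposition 12.7)

Solo programme `solo-AtomisticToContinuum-blind`, session 5.

Informal setting (NOT formalised here): hard-core bosons on a torus `Λ ⊂ ℤᵈ`, hopping `t = 1/2`,
`E_p = ∑ᵢ (1 - cos pᵢ)`, `N`-particle ground state `Ψ_N`, filling `ρ = N/|Λ|`, mode occupations
`n_p = ⟨b_p† b_p⟩`, and, for an admissible reference chemical potential `μ`, the two-sided one-particle
susceptibility `m₋₁(p;μ)` and first moment `m₁(μ)` of the spectral measure of `b_p† Ψ_N ⊕ b_p Ψ_N`.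
The operator-theoretic inputs
* (♣)   `(2 n_p + 1 - 2ρ)² ≤ m₁ · m₋₁`      (Cauchy–Schwarz; `m₀ = 2 n_p + 1 - 2ρ` by the hard-core commutator),
* (m₁)  `m₁ ≤ (1 - 4ρ) E_p + 4 d ρ`          (double-commutator bound, `μ ≥ -d`, `E_p ≤ 1`),
* (kin) `∑_p E_p n_p ≤ d ρ N`                 (trial-state energy bound `E_N ≤ -dN(V-N)/(V-1)`),
are taken as hypotheses on real numbers indexed by a finite set of nonzero modes, together with the
CONJECTURED windowed Gaussian-domination bound
* (GD_C) `E_p · m₋₁(p;μ) ≤ C` for `p` in an infrared window `W`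
(a theorem only at half filling, `μ = 0`, `C = 1`: Lieb–Seiringer–Solovej–Yngvason 2005, (11.8)).
The theorems below are the bookkeeping of Proposition 12.7 of the solo paper: (GD_C) on the window turns
into an explicit bound on the depletion `∑_{p ≠ 0} n_p`, with the loss `(√C - 1)/2` per window mode explicit.
No physics is formalised; this is the real-inequality skeleton isolating (GD_C) as the only non-elementary
input of the lattice rung.
-/

namespace Summit.AtomisticToContinuum.BoseEinsteinCondensation.Theorems

open Finset

/-- Per-mode step, raw form: (♣) + (GD_C) + the first-moment bound give
`2 n + 1 - 2ρ ≤ √(C (1 - 4ρ) + 4 C d ρ / E)`. -/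
theorem twoSidedMoment_le_sqrt_of_gd
    {n m1 mm1 E C ρ d : ℝ} (hE : 0 < E) (hρ0 : 0 ≤ ρ) (hρ : ρ ≤ 1 / 4) (hd : 0 ≤ d)
    (hmm1 : 0 ≤ mm1)
    (hclubs : (2 * n + 1 - 2 * ρ) ^ 2 ≤ m1 * mm1)
    (hgd : E * mm1 ≤ C)
    (hm1 : m1 ≤ (1 - 4 * ρ) * E + 4 * d * ρ) :
    2 * n + 1 - 2 * ρ ≤ Real.sqrt (C * (1 - 4 * ρ) + 4 * C * d * ρ / E) := by
  have hdiv : mm1 ≤ C / E := by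
    rw [le_div_iff₀ hE]; linarith [hgd]
  have hB : 0 ≤ (1 - 4 * ρ) * E + 4 * d * ρ := by
    have h1 : 0 ≤ (1 - 4 * ρ) * E := mul_nonneg (by linarith) hE.le
    have h2 : 0 ≤ 4 * d * ρ := by positivity
    linarith
  have hY : (2 * n + 1 - 2 * ρ) ^ 2 ≤ C * (1 - 4 * ρ) + 4 * C * d * ρ / E := by
    calc (2 * n + 1 - 2 * ρ) ^ 2 ≤ m1 * mm1 := hclubs
      _ ≤ ((1 - 4 * ρ) * E + 4 * d * ρ) * mm1 := mul_le_mul_of_nonneg_right hm1 hmm1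
      _ ≤ ((1 - 4 * ρ) * E + 4 * d * ρ) * (C / E) := mul_le_mul_of_nonneg_left hdiv hB
      _ = C * (1 - 4 * ρ) + 4 * C * d * ρ / E := by field_simp
  calc 2 * n + 1 - 2 * ρ ≤ |2 * n + 1 - 2 * ρ| := le_abs_self _
    _ ≤ Real.sqrt (C * (1 - 4 * ρ) + 4 * C * d * ρ / E) := Real.abs_le_sqrt hY

/-- Per-mode step, clean form: `n_p ≤ (√C - 1)/2 · (1 - 2ρ) + √(C d ρ / E_p)`.
The first term is the intrinsic loss of a Gaussian-domination constant `C > 1`; it vanishes at the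
reflection-positivity value `C = 1`. -/
theorem modeOccupation_le_of_gd
    {n m1 mm1 E C ρ d : ℝ} (hE : 0 < E) (hC : 0 ≤ C) (hρ0 : 0 ≤ ρ) (hρ : ρ ≤ 1 / 4) (hd : 0 ≤ d)
    (hmm1 : 0 ≤ mm1)
    (hclubs : (2 * n + 1 - 2 * ρ) ^ 2 ≤ m1 * mm1)
    (hgd : E * mm1 ≤ C)
    (hm1 : m1 ≤ (1 - 4 * ρ) * E + 4 * d * ρ) :
    n ≤ (Real.sqrt C - 1) / 2 * (1 - 2 * ρ) + Real.sqrt (C * d * ρ / E) := by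
  have hraw := twoSidedMoment_le_sqrt_of_gd hE hρ0 hρ hd hmm1 hclubs hgd hm1
  have ha : 0 ≤ C * (1 - 4 * ρ) := mul_nonneg hC (by linarith)
  have hb : 0 ≤ 4 * C * d * ρ / E := by positivity
  -- subadditivity of the square root (folklore; inlined to keep this file import-light)
  have hsplit : Real.sqrt (C * (1 - 4 * ρ) + 4 * C * d * ρ / E)
      ≤ Real.sqrt (C * (1 - 4 * ρ)) + Real.sqrt (4 * C * d * ρ / E) := by
    rw [Real.sqrt_le_left (by positivity)]
    nlinarith [Real.sq_sqrt ha, Real.sq_sqrt hb, Real.sqrt_nonneg (C * (1 - 4 * ρ)),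
      Real.sqrt_nonneg (4 * C * d * ρ / E),
      mul_nonneg (Real.sqrt_nonneg (C * (1 - 4 * ρ))) (Real.sqrt_nonneg (4 * C * d * ρ / E))]
  have h1 : Real.sqrt (C * (1 - 4 * ρ)) ≤ Real.sqrt C * (1 - 2 * ρ) := by
    rw [Real.sqrt_mul hC]
    apply mul_le_mul_of_nonneg_left _ (Real.sqrt_nonneg C)
    rw [Real.sqrt_le_left (by linarith)]
    nlinarith [sq_nonneg ρ]
  have h2 : Real.sqrt (4 * C * d * ρ / E) = 2 * Real.sqrt (C * d * ρ / E) := by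
    have : 4 * C * d * ρ / E = 4 * (C * d * ρ / E) := by ring
    rw [this, Real.sqrt_mul (by norm_num : (0:ℝ) ≤ 4)]
    rw [show (4:ℝ) = 2 ^ 2 by norm_num, Real.sqrt_sq (by norm_num)]
  linarith [hraw, hsplit, h1, h2]

/-- (♣) alone forces `C ≥ (1-2ρ)² E_p / m₁` wherever (GD_C) holds with `m₁ > 0`: no constant below the
free value can hold on the whole zone (the loss term above is intrinsic). -/
theorem gd_constant_lower_bound
    {n m1 mm1 E C ρ : ℝ} (hE : 0 < E) (hρ : ρ ≤ 1 / 2) (hn : 0 ≤ n) (hm1 : 0 < m1)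
    (hclubs : (2 * n + 1 - 2 * ρ) ^ 2 ≤ m1 * mm1) (hgd : E * mm1 ≤ C) :
    (1 - 2 * ρ) ^ 2 * E / m1 ≤ C := by
  have hX : (1 - 2 * ρ) ^ 2 ≤ (2 * n + 1 - 2 * ρ) ^ 2 := by
    have h0 : 0 ≤ 1 - 2 * ρ := by linarith
    nlinarith
  have hmm1 : (1 - 2 * ρ) ^ 2 / m1 ≤ mm1 := by
    rw [div_le_iff₀ hm1]; nlinarith
  calc (1 - 2 * ρ) ^ 2 * E / m1 = E * ((1 - 2 * ρ) ^ 2 / m1) := by ring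
    _ ≤ E * mm1 := mul_le_mul_of_nonneg_left hmm1 hE.le
    _ ≤ C := hgd

/-- **Proposition 12.7 (abstract bookkeeping).**  Modes `P` (all `p ≠ 0`), an infrared window `W ⊆ P`
on which (♣), (GD_C) and the first-moment bound hold, `E_p ≥ η` off the window, and the kinetic bound
`∑_P E_p n_p ≤ d ρ N`.  Then the depletion obeys
`∑_P n_p ≤ |W| · (√C - 1)/2 · (1 - 2ρ) + ∑_W √(C d ρ / E_p) + d ρ N / η`. -/
theorem depletion_le_of_windowed_gd {ι : Type*} [DecidableEq ι]
    (P W : Finset ι) (hWP : W ⊆ P) (E n m1 mm1 : ι → ℝ) {C ρ d η Ntot : ℝ}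
    (hE : ∀ p ∈ P, 0 < E p) (hn : ∀ p ∈ P, 0 ≤ n p)
    (hC : 0 ≤ C) (hρ0 : 0 ≤ ρ) (hρ : ρ ≤ 1 / 4) (hd : 0 ≤ d) (hη : 0 < η)
    (hwin : ∀ p ∈ P, p ∉ W → η ≤ E p)
    (hmm1 : ∀ p ∈ W, 0 ≤ mm1 p)
    (hclubs : ∀ p ∈ W, (2 * n p + 1 - 2 * ρ) ^ 2 ≤ m1 p * mm1 p)
    (hgd : ∀ p ∈ W, E p * mm1 p ≤ C)
    (hm1 : ∀ p ∈ W, m1 p ≤ (1 - 4 * ρ) * E p + 4 * d * ρ)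
    (hkin : ∑ p ∈ P, E p * n p ≤ d * ρ * Ntot) :
    ∑ p ∈ P, n p ≤ (W.card : ℝ) * ((Real.sqrt C - 1) / 2 * (1 - 2 * ρ))
        + ∑ p ∈ W, Real.sqrt (C * d * ρ / E p) + d * ρ * Ntot / η := by
  -- window part
  have hA : ∑ p ∈ W, n p ≤ ∑ p ∈ W, ((Real.sqrt C - 1) / 2 * (1 - 2 * ρ) + Real.sqrt (C * d * ρ / E p)) := by
    apply Finset.sum_le_sum
    intro p hp
    exact modeOccupation_le_of_gd (hE p (hWP hp)) hC hρ0 hρ hd (hmm1 p hp)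
      (hclubs p hp) (hgd p hp) (hm1 p hp)
  have hA' : ∑ p ∈ W, ((Real.sqrt C - 1) / 2 * (1 - 2 * ρ) + Real.sqrt (C * d * ρ / E p))
      = (W.card : ℝ) * ((Real.sqrt C - 1) / 2 * (1 - 2 * ρ)) + ∑ p ∈ W, Real.sqrt (C * d * ρ / E p) := by
    rw [Finset.sum_add_distrib, Finset.sum_const, nsmul_eq_mul]
  -- tail part
  have hB : ∑ p ∈ P \ W, n p ≤ (∑ p ∈ P \ W, E p * n p) / η := by
    rw [Finset.sum_div]
    apply Finset.sum_le_sum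
    intro p hp
    rw [Finset.mem_sdiff] at hp
    rw [le_div_iff₀ hη]
    have h1 := hwin p hp.1 hp.2
    have h2 := hn p hp.1
    nlinarith
  have hB' : ∑ p ∈ P \ W, E p * n p ≤ ∑ p ∈ P, E p * n p := by
    apply Finset.sum_le_sum_of_subset_of_nonneg Finset.sdiff_subset
    intro p hp _
    exact mul_nonneg (hE p hp).le (hn p hp)
  have hB'' : (∑ p ∈ P \ W, E p * n p) / η ≤ d * ρ * Ntot / η :=
    div_le_div_of_nonneg_right (hB'.trans hkin) hη.le
  -- assemble
  have hsplit : ∑ p ∈ P, n p = ∑ p ∈ P \ W, n p + ∑ p ∈ W, n p := (Finset.sum_sdiff hWP).symm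
  rw [hsplit]
  linarith [hA, hA', hB, hB'']

end Summit.AtomisticToContinuum.BoseEinsteinCondensation.Theorems
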